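import Mathlib
import Summits.MatrixMultiplication.MatrixMultiplication.Theorems.SubgroupIdentityDesigns.Negative.TwoPMemberLaw
import Summits.MatrixMultiplication.MatrixMultiplication.Theorems.SubgroupIdentityDesigns.Negative.OnePMemberLaw
import Summits.MatrixMultiplication.MatrixMultiplication.Theorems.SubgroupIdentityDesigns.Negative.SylowFrames
import Summits.MatrixMultiplication.MatrixMultiplication.Theorems.SubgroupIdentityDesigns.Negative.Reversal
import Summits.MatrixMultiplication.MatrixMultiplication.Theorems.SubgroupIdentityDesigns.Negative.BorelCounting

/-!
# End placements of the `(2,1)` cell: hypothesis-light no-witness theorems (all `p`)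

Route `LevelGradedCohnUmans`, crux `SubgroupIdentityDesigns`, the `(m,k) = (2,1)` cell.

Packaging of the volume laws (`TwoPMemberLaw`, `OnePMemberLaw`) with the Borel frame
(`SylowFrames.exists_borel_frame_of_disjoint`) and reversal (`Reversal.design_reverse`):

* `no_levelOne_witness_two_pMembers₁₂ / ₁₃ / ₂₃` (all primes `p ≥ 3`, all `0 < ε ≤ 1`): a
  subgroup-TPP triple of `GL₂(𝔽_p)` with (at least) TWO members of order divisible by `p` and a
  level-`1` identity design never satisfies the crux inequality — no shape hypothesis at all
  (`|H₁||H₂||H₃| ≤ p²(p²-1) ≤ 1 + p³ + (p-2)(p+1)³`).  Together with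
  `ThreeSylowLaw.no_threeSylow_witness` the `(2,1)` cell needs a triple with AT MOST ONE `p`-member.
* `no_levelOne_witness_borel_first / _last` (all primes `p ≥ 5`): if the first (or last) member is
  conjugate to a subgroup `K` with `U⁺ ≤ K ≤ B⁺` (a `p`-member with a unique Sylow `p`-subgroup),
  the other two members being ARBITRARY, there is no level-one witness
  (`|H₁||H₂||H₃| ≤ p(p+1)²(p-1)`).

Tools (`BorelCounting`): the diagonal part of a subgroup (`exists_diag_part`) and the Borel
counting `|K| ≤ p·|K ∩ T|` for `U^± ≤ K ≤ B^±` (`card_le_mul_diag_upper/lower`).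

What is left of the `(2,1)` cell after this file: one `p`-member in the MIDDLE position, one
`p`-member containing `SL₂(𝔽_p)`, `p`-free triples, and `p = 3`.
VALUE = THEOREM (all `p`), NOT summit progress; the crux item stmt-MatrixMultiplication-14079 is
untouched and remains open.
-/

set_option linter.dupNamespace false

noncomputable section

open scoped BigOperators Classical

open Summit.MatrixMultiplication.MatrixMultiplication.Theorems.LieRankDesigns.Negative
  (GLm Mat fourierFn budget)
open Summit.MatrixMultiplication.MatrixMultiplication.Theorems.LevelOneGL2Designs.Negative
  (levelSubmodule fourierFn_mem_levelSubmodule)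

namespace Summit.MatrixMultiplication.MatrixMultiplication.Theorems.SubgroupIdentityDesigns.Negative

section EndPlacements

open Literature.Barriers.MatrixMultiplication (SubgroupTPP)

variable {p : ℕ} [hp : Fact p.Prime]

omit hp in
/-- The subgroup TPP is invariant under reversal `(H₁, H₂, H₃) ↦ (H₃, H₂, H₁)`. -/
theorem subgroupTPP_reverse {H₁ H₂ H₃ : Subgroup (GLm p 2)} (h : SubgroupTPP H₁ H₂ H₃) :
    SubgroupTPP H₃ H₂ H₁ := by
  intro c hc b hb a ha habc
  have h1 : a⁻¹ * b⁻¹ * c⁻¹ = 1 := by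
    rw [← mul_inv_rev, ← mul_inv_rev, ← mul_assoc, habc, inv_one]
  obtain ⟨ha1, hb1, hc1⟩ := h a⁻¹ (H₁.inv_mem ha) b⁻¹ (H₂.inv_mem hb) c⁻¹ (H₃.inv_mem hc) h1
  exact ⟨inv_eq_one.mp hc1, inv_eq_one.mp hb1, inv_eq_one.mp ha1⟩

/-- **Frame bound from a Borel frame.**  `U⁺ ≤ H₁ ≤ B⁺`, `U⁻ ≤ H₃' ≤ B⁻`-type data is turned into
the numeric frame hypotheses of the volume laws: this is the two-`p`-member bound
`|H₁||H₂||H₃| ≤ p²(p²-1)` for a conjugated frame in placement `(B⁺, B⁻, *)`. -/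
theorem volume_le_of_frame₁₂ {H₁ H₂ H₃ : Subgroup (GLm p 2)} (htpp : SubgroupTPP H₁ H₂ H₃)
    (hB₁ : ∀ k ∈ H₁, (k : Mat p 2) 1 0 = 0)
    (hU₁ : ∀ u : GLm p 2, (u : Mat p 2) 1 0 = 0 → (u : Mat p 2) 0 0 = 1 → (u : Mat p 2) 1 1 = 1 →
      u ∈ H₁)
    (hB₂ : ∀ k ∈ H₂, (k : Mat p 2) 0 1 = 0)
    (hU₂ : ∀ u : GLm p 2, (u : Mat p 2) 0 1 = 0 → (u : Mat p 2) 0 0 = 1 → (u : Mat p 2) 1 1 = 1 →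
      u ∈ H₂)
    (hdesign : ∃ f ∈ levelSubmodule p 2 1, f 1 = 1 ∧
      ∀ a ∈ H₁, ∀ b ∈ H₂, ∀ c ∈ H₃, a * b * c ≠ 1 → f (a * b * c) = 0) :
    Nat.card H₁ * Nat.card H₂ * Nat.card H₃ ≤ p * p * ((p - 1) * (p + 1)) := by
  obtain ⟨D₁, hD₁le, hd₁, hD₁B⟩ := exists_diag_part H₁
  obtain ⟨D₂, hD₂le, hd₂, hD₂B⟩ := exists_diag_part H₂
  have hK₁ := card_le_mul_diag_upper hB₁ hU₁ hD₁B
  have hK₂ := card_le_mul_diag_lower hB₂ hU₂ hD₂B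
  have h := volume_law_two_pMembers htpp hU₁ hD₁le hD₂le hd₁ hd₂ hdesign
  calc Nat.card H₁ * Nat.card H₂ * Nat.card H₃
      ≤ p * Nat.card D₁ * (p * Nat.card D₂) * Nat.card H₃ :=
        Nat.mul_le_mul (Nat.mul_le_mul hK₁ hK₂) le_rfl
    _ = p * p * (Nat.card D₁ * Nat.card D₂ * Nat.card H₃) := by ring
    _ ≤ p * p * ((p - 1) * (p + 1)) := Nat.mul_le_mul_left _ h

/-- The same for the placement `(B⁺, *, B⁻)`. -/
theorem volume_le_of_frame₁₃ {H₁ H₂ H₃ : Subgroup (GLm p 2)} (htpp : SubgroupTPP H₁ H₂ H₃)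
    (hB₁ : ∀ k ∈ H₁, (k : Mat p 2) 1 0 = 0)
    (hU₁ : ∀ u : GLm p 2, (u : Mat p 2) 1 0 = 0 → (u : Mat p 2) 0 0 = 1 → (u : Mat p 2) 1 1 = 1 →
      u ∈ H₁)
    (hB₃ : ∀ k ∈ H₃, (k : Mat p 2) 0 1 = 0)
    (hU₃ : ∀ u : GLm p 2, (u : Mat p 2) 0 1 = 0 → (u : Mat p 2) 0 0 = 1 → (u : Mat p 2) 1 1 = 1 →
      u ∈ H₃)
    (hdesign : ∃ f ∈ levelSubmodule p 2 1, f 1 = 1 ∧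
      ∀ a ∈ H₁, ∀ b ∈ H₂, ∀ c ∈ H₃, a * b * c ≠ 1 → f (a * b * c) = 0) :
    Nat.card H₁ * Nat.card H₂ * Nat.card H₃ ≤ p * p * ((p - 1) * (p + 1)) := by
  obtain ⟨D₁, hD₁le, hd₁, hD₁B⟩ := exists_diag_part H₁
  obtain ⟨D₃, hD₃le, hd₃, hD₃B⟩ := exists_diag_part H₃
  have hK₁ := card_le_mul_diag_upper hB₁ hU₁ hD₁B
  have hK₃ := card_le_mul_diag_lower hB₃ hU₃ hD₃B
  have h := volume_law_frame13 htpp hU₁ hD₁le hD₃le hd₁ hd₃ hdesign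
  calc Nat.card H₁ * Nat.card H₂ * Nat.card H₃
      ≤ p * Nat.card D₁ * Nat.card H₂ * (p * Nat.card D₃) :=
        Nat.mul_le_mul (Nat.mul_le_mul_right _ hK₁) hK₃
    _ = p * p * (Nat.card D₁ * Nat.card H₂ * Nat.card D₃) := by ring
    _ ≤ p * p * ((p - 1) * (p + 1)) := Nat.mul_le_mul_left _ h

/-- **NO LEVEL-ONE WITNESS WITH TWO `p`-MEMBERS, positions 1 and 2** (all primes `p ≥ 3`, all
`0 < ε ≤ 1`, no shape hypothesis). -/
theorem no_levelOne_witness_two_pMembers₁₂ (hp3 : 3 ≤ p) {ε : ℝ} (hε : 0 < ε) (hε1 : ε ≤ 1)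
    {H₁ H₂ H₃ : Subgroup (GLm p 2)} (htpp : SubgroupTPP H₁ H₂ H₃)
    (h₁ : p ∣ Nat.card H₁) (h₂ : p ∣ Nat.card H₂)
    (hdesign : ∃ c : Mat p 2 → ℂ, (∀ M, 1 < M.rank → c M = 0) ∧
      (∑ M, c M * ZMod.stdAddChar (Matrix.trace (M * ((1 : GLm p 2) : Mat p 2)))) = 1 ∧
      ∀ a ∈ H₁, ∀ b ∈ H₂, ∀ g ∈ H₃, a * b * g ≠ 1 →
        (∑ M, c M *
          ZMod.stdAddChar (Matrix.trace (M * ((a * b * g : GLm p 2) : Mat p 2)))) = 0) :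
    ¬ budget p 2 1 (2 + ε) <
      ((Nat.card H₁ * Nat.card H₂ * Nat.card H₃ : ℕ) : ℝ) ^ ((2 + ε) / 3) := by
  obtain ⟨c, hc, hc1, hc0⟩ := hdesign
  obtain ⟨g, hB, hU, hB', hU', htpp'⟩ := exists_borel_frame_of_tpp htpp h₁ h₂
  have hdes' := idTest_map_conj g
    (⟨fourierFn c, fourierFn_mem_levelSubmodule hc, hc1, fun a ha b hb g hg hne =>
      hc0 a ha b hb g hg hne⟩ : ∃ f ∈ levelSubmodule p 2 1, f 1 = 1 ∧
      ∀ a ∈ H₁, ∀ b ∈ H₂, ∀ c ∈ H₃, a * b * c ≠ 1 → f (a * b * c) = 0)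
  have h := volume_le_of_frame₁₂ htpp' hB hU hB' hU' hdes'
  rw [card_map_conj_eq H₁ g⁻¹, card_map_conj_eq H₂ g⁻¹, card_map_conj_eq H₃ g⁻¹] at h
  exact no_levelOne_witness_of_volume_le_nat (by linarith) hε1
    (h.trans (sq_mul_pred_mul_succ_le_floor hp3))

/-- **NO LEVEL-ONE WITNESS WITH TWO `p`-MEMBERS, positions 1 and 3** (all primes `p ≥ 3`). -/
theorem no_levelOne_witness_two_pMembers₁₃ (hp3 : 3 ≤ p) {ε : ℝ} (hε : 0 < ε) (hε1 : ε ≤ 1)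
    {H₁ H₂ H₃ : Subgroup (GLm p 2)} (htpp : SubgroupTPP H₁ H₂ H₃)
    (h₁ : p ∣ Nat.card H₁) (h₃ : p ∣ Nat.card H₃)
    (hdesign : ∃ c : Mat p 2 → ℂ, (∀ M, 1 < M.rank → c M = 0) ∧
      (∑ M, c M * ZMod.stdAddChar (Matrix.trace (M * ((1 : GLm p 2) : Mat p 2)))) = 1 ∧
      ∀ a ∈ H₁, ∀ b ∈ H₂, ∀ g ∈ H₃, a * b * g ≠ 1 →
        (∑ M, c M *
          ZMod.stdAddChar (Matrix.trace (M * ((a * b * g : GLm p 2) : Mat p 2)))) = 0) :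
    ¬ budget p 2 1 (2 + ε) <
      ((Nat.card H₁ * Nat.card H₂ * Nat.card H₃ : ℕ) : ℝ) ^ ((2 + ε) / 3) := by
  obtain ⟨c, hc, hc1, hc0⟩ := hdesign
  obtain ⟨g, hB, hU, hB', hU'⟩ :=
    exists_borel_frame_of_disjoint (StandardLines.subgroupTPP_disjoint htpp).2.1 h₁ h₃
  have htpp' : SubgroupTPP (H₁.map (MulAut.conj g⁻¹).toMonoidHom)
      (H₂.map (MulAut.conj g⁻¹).toMonoidHom) (H₃.map (MulAut.conj g⁻¹).toMonoidHom) :=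
    subgroupTPP_map_of_injective _ (MulAut.conj g⁻¹).injective htpp
  have hdes' := idTest_map_conj g
    (⟨fourierFn c, fourierFn_mem_levelSubmodule hc, hc1, fun a ha b hb g hg hne =>
      hc0 a ha b hb g hg hne⟩ : ∃ f ∈ levelSubmodule p 2 1, f 1 = 1 ∧
      ∀ a ∈ H₁, ∀ b ∈ H₂, ∀ c ∈ H₃, a * b * c ≠ 1 → f (a * b * c) = 0)
  have h := volume_le_of_frame₁₃ htpp' hB hU hB' hU' hdes'
  rw [card_map_conj_eq H₁ g⁻¹, card_map_conj_eq H₂ g⁻¹, card_map_conj_eq H₃ g⁻¹] at h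
  exact no_levelOne_witness_of_volume_le_nat (by linarith) hε1
    (h.trans (sq_mul_pred_mul_succ_le_floor hp3))

/-- **NO LEVEL-ONE WITNESS WITH TWO `p`-MEMBERS, positions 2 and 3** (all primes `p ≥ 3`; by
reversal). -/
theorem no_levelOne_witness_two_pMembers₂₃ (hp3 : 3 ≤ p) {ε : ℝ} (hε : 0 < ε) (hε1 : ε ≤ 1)
    {H₁ H₂ H₃ : Subgroup (GLm p 2)} (htpp : SubgroupTPP H₁ H₂ H₃)
    (h₂ : p ∣ Nat.card H₂) (h₃ : p ∣ Nat.card H₃)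
    (hdesign : ∃ c : Mat p 2 → ℂ, (∀ M, 1 < M.rank → c M = 0) ∧
      (∑ M, c M * ZMod.stdAddChar (Matrix.trace (M * ((1 : GLm p 2) : Mat p 2)))) = 1 ∧
      ∀ a ∈ H₁, ∀ b ∈ H₂, ∀ g ∈ H₃, a * b * g ≠ 1 →
        (∑ M, c M *
          ZMod.stdAddChar (Matrix.trace (M * ((a * b * g : GLm p 2) : Mat p 2)))) = 0) :
    ¬ budget p 2 1 (2 + ε) <
      ((Nat.card H₁ * Nat.card H₂ * Nat.card H₃ : ℕ) : ℝ) ^ ((2 + ε) / 3) := by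
  have h := no_levelOne_witness_two_pMembers₁₂ hp3 hε hε1 (subgroupTPP_reverse htpp) h₃ h₂
    (Reversal.design_reverse H₁ H₂ H₃ hdesign)
  rwa [show Nat.card H₃ * Nat.card H₂ * Nat.card H₁ = Nat.card H₁ * Nat.card H₂ * Nat.card H₃ by
    ring] at h

/-- **NO LEVEL-ONE WITNESS WITH A BOREL-TYPE `p`-MEMBER IN FRONT** (all primes `p ≥ 5`, all
`0 < ε ≤ 1`; `H₂, H₃` arbitrary): if `H₁` is conjugate to a subgroup `K` with `U⁺ ≤ K ≤ B⁺`. -/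
theorem no_levelOne_witness_borel_first (hp5 : 5 ≤ p) {ε : ℝ} (hε : 0 < ε) (hε1 : ε ≤ 1)
    {H₁ H₂ H₃ : Subgroup (GLm p 2)} (htpp : SubgroupTPP H₁ H₂ H₃)
    (hframe : ∃ g : GLm p 2, (∀ k ∈ H₁.map (MulAut.conj g⁻¹).toMonoidHom, (k : Mat p 2) 1 0 = 0) ∧
      ∀ u : GLm p 2, (u : Mat p 2) 1 0 = 0 → (u : Mat p 2) 0 0 = 1 → (u : Mat p 2) 1 1 = 1 →
        u ∈ H₁.map (MulAut.conj g⁻¹).toMonoidHom)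
    (hdesign : ∃ c : Mat p 2 → ℂ, (∀ M, 1 < M.rank → c M = 0) ∧
      (∑ M, c M * ZMod.stdAddChar (Matrix.trace (M * ((1 : GLm p 2) : Mat p 2)))) = 1 ∧
      ∀ a ∈ H₁, ∀ b ∈ H₂, ∀ g ∈ H₃, a * b * g ≠ 1 →
        (∑ M, c M *
          ZMod.stdAddChar (Matrix.trace (M * ((a * b * g : GLm p 2) : Mat p 2)))) = 0) :
    ¬ budget p 2 1 (2 + ε) <
      ((Nat.card H₁ * Nat.card H₂ * Nat.card H₃ : ℕ) : ℝ) ^ ((2 + ε) / 3) := by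
  obtain ⟨c, hc, hc1, hc0⟩ := hdesign
  obtain ⟨g, hB, hU⟩ := hframe
  have htpp' : SubgroupTPP (H₁.map (MulAut.conj g⁻¹).toMonoidHom)
      (H₂.map (MulAut.conj g⁻¹).toMonoidHom) (H₃.map (MulAut.conj g⁻¹).toMonoidHom) :=
    subgroupTPP_map_of_injective _ (MulAut.conj g⁻¹).injective htpp
  have hdes' := idTest_map_conj g
    (⟨fourierFn c, fourierFn_mem_levelSubmodule hc, hc1, fun a ha b hb g hg hne =>
      hc0 a ha b hb g hg hne⟩ : ∃ f ∈ levelSubmodule p 2 1, f 1 = 1 ∧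
      ∀ a ∈ H₁, ∀ b ∈ H₂, ∀ c ∈ H₃, a * b * c ≠ 1 → f (a * b * c) = 0)
  obtain ⟨D₁, hD₁le, hd₁, hD₁B⟩ := exists_diag_part (H₁.map (MulAut.conj g⁻¹).toMonoidHom)
  have hK₁ := card_le_mul_diag_upper hB hU hD₁B
  have h := volume_law_onePMember htpp' hU hD₁le hd₁ hdes'
  rw [card_map_conj_eq H₂ g⁻¹, card_map_conj_eq H₃ g⁻¹] at h
  rw [card_map_conj_eq H₁ g⁻¹] at hK₁
  refine no_levelOne_witness_of_volume_le_nat (by linarith) hε1 ?_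
  calc Nat.card H₁ * Nat.card H₂ * Nat.card H₃
      ≤ p * Nat.card D₁ * Nat.card H₂ * Nat.card H₃ :=
        Nat.mul_le_mul_right _ (Nat.mul_le_mul_right _ hK₁)
    _ = p * (Nat.card D₁ * Nat.card H₂ * Nat.card H₃) := by ring
    _ ≤ p * ((p - 1) * (p + 1) * (p + 1)) := Nat.mul_le_mul_left _ h
    _ = p * ((p + 1) * (p + 1)) * (p - 1) := by ring
    _ ≤ 1 + p ^ 3 + (p - 2) * (p + 1) ^ 3 := mul_succ_sq_mul_pred_le_floor hp5

/-- **NO LEVEL-ONE WITNESS WITH A BOREL-TYPE `p`-MEMBER AT THE END** (all primes `p ≥ 5`; by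
reversal). -/
theorem no_levelOne_witness_borel_last (hp5 : 5 ≤ p) {ε : ℝ} (hε : 0 < ε) (hε1 : ε ≤ 1)
    {H₁ H₂ H₃ : Subgroup (GLm p 2)} (htpp : SubgroupTPP H₁ H₂ H₃)
    (hframe : ∃ g : GLm p 2, (∀ k ∈ H₃.map (MulAut.conj g⁻¹).toMonoidHom, (k : Mat p 2) 1 0 = 0) ∧
      ∀ u : GLm p 2, (u : Mat p 2) 1 0 = 0 → (u : Mat p 2) 0 0 = 1 → (u : Mat p 2) 1 1 = 1 →
        u ∈ H₃.map (MulAut.conj g⁻¹).toMonoidHom)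
    (hdesign : ∃ c : Mat p 2 → ℂ, (∀ M, 1 < M.rank → c M = 0) ∧
      (∑ M, c M * ZMod.stdAddChar (Matrix.trace (M * ((1 : GLm p 2) : Mat p 2)))) = 1 ∧
      ∀ a ∈ H₁, ∀ b ∈ H₂, ∀ g ∈ H₃, a * b * g ≠ 1 →
        (∑ M, c M *
          ZMod.stdAddChar (Matrix.trace (M * ((a * b * g : GLm p 2) : Mat p 2)))) = 0) :
    ¬ budget p 2 1 (2 + ε) <
      ((Nat.card H₁ * Nat.card H₂ * Nat.card H₃ : ℕ) : ℝ) ^ ((2 + ε) / 3) := by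
  have h := no_levelOne_witness_borel_first hp5 hε hε1 (subgroupTPP_reverse htpp) hframe
    (Reversal.design_reverse H₁ H₂ H₃ hdesign)
  rwa [show Nat.card H₃ * Nat.card H₂ * Nat.card H₁ = Nat.card H₁ * Nat.card H₂ * Nat.card H₃ by
    ring] at h

end EndPlacements

end Summit.MatrixMultiplication.MatrixMultiplication.Theorems.SubgroupIdentityDesigns.Negative

end
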